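import Summits.AtomisticToContinuum.Crystallization.Theses.PhononSlackCertificates

/-!
# Crux `CoerciveTwoShellGap` (stmt-AtomisticToContinuum-13956) — ideator 2, round 1: sketch file

First lemmas of the idea card `gap-placed-handover` (card A) and the supporting sign /
omission facts that survived from a second, DISCARDED lever (`vacuum-split-adhesion`, dropped
before filing: its budget does not close — see the ideator's NOTES.md §Barrier notes B2), all
stated over existing declarations (`IsTwoShellGood`, `fccInt`, `fccSecondShellInt`, `hcpInt`,
`hcpSecondShellInt`, `sqNormInt`, `lennardJones`, `interactionEnergy`,
`PeriodicConfiguration.energyPerParticle`).  What is PROVED here (kernel-checked, no sorry):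

* `fcc_cap_contacts` / `hcp_cap_contacts` / `fcc_cap_others` / `hcp_cap_others`: in both two-shell
  patterns every second-shell point has EXACTLY four first-shell points at contact distance `a`
  and all other first-shell points at distance `≥ √3·a` (integer models, `decide`) — the "square
  cap" structure behind the selector of card A;
* `lennardJones_neg`: `V_LJ(r) < 0` for `r ≥ 0.893`;
* `dist_ge_of_good`, `attractive_at_good`: every other particle is at distance `≥ 0.893` from a
  `1/20`-good particle (window `[47/50, 1]`), hence EVERY bond at a good particle is strictly
  attractive — the sign fact used by card A's near side (omission defects remove only
  ATTRACTIVE bonds, so free-surface / void boundary terms have a sign) and by any cut-based glue.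

* `good_shell_dichotomy`, `good_gap_empty` (§5): the METRIC clauses of Lemma A — at the scale of
  a goodness witness every other particle within `3a/2` lies in `[0.95a, 1.05a]` or in
  `[1.364a, 1.465a]` (so the selector's gap `(1.12a, 1.28a)` is empty) and any two of them are
  `≥ 0.9a` apart.

What is only STATED (defs of `Prop`s, to be proved by a line): `GoodImpCapRegular` (card A,
lemma A: good ⇒ cap-regular; its counting clauses `12 / 6 / 4 contacts` remain, provable now from
the pattern API + §1), `CapRegularRigidity` (card A, lemma B), `OmissionGap` (the crux restricted
to sub-good configurations = the near field IN VACUUM, card A's recommended first milestone).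
-/

noncomputable section

namespace Summit.AtomisticToContinuum.Crystallization.Cruxes.CoerciveTwoShellGap.IdeatorTwo

open Literature.Geometry.DiscreteGeometry Literature.MathematicalPhysics.StatisticalMechanics

/-- Local abbreviation. [folklore] -/
abbrev E3 := EuclideanSpace ℝ (Fin 3)

/-! ## §1  Square caps: the second shell sits over the six square faces (integer models) -/

/-- fcc: each second-shell vector has exactly four first-shell vectors at squared distance `2`
(contact distance `a` after scaling by `1/√2`). [folklore] -/
theorem fcc_cap_contacts :
    ∀ v ∈ fccSecondShellInt, (fccInt.filter fun w => sqNormInt (v - w) = 2).card = 4 := by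
  decide

/-- fcc: a first-shell vector not in contact with a second-shell vector is at squared distance
`≥ 6` from it (distance `≥ √3·a`). [folklore] -/
theorem fcc_cap_others :
    ∀ v ∈ fccSecondShellInt, ∀ w ∈ fccInt, sqNormInt (v - w) = 2 ∨ 6 ≤ sqNormInt (v - w) := by
  decide

/-- hcp: each second-shell vector has exactly four first-shell vectors at squared distance `18`
(contact distance `a` after scaling by `1/(3√2)`). [folklore] -/
theorem hcp_cap_contacts :
    ∀ v ∈ hcpSecondShellInt, (hcpInt.filter fun w => sqNormInt (v - w) = 18).card = 4 := by
  decide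

/-- hcp: a first-shell vector not in contact with a second-shell vector is at squared distance
`≥ 54` from it (distance `≥ √3·a`). [folklore] -/
theorem hcp_cap_others :
    ∀ v ∈ hcpSecondShellInt, ∀ w ∈ hcpInt, sqNormInt (v - w) = 18 ∨ 54 ≤ sqNormInt (v - w) := by
  decide

/-- fcc: distinct second-shell vectors are at squared distance `≥ 8` (distance `≥ 2a`). [folklore] -/
theorem fcc_second_shell_separated :
    ∀ v ∈ fccSecondShellInt, ∀ w ∈ fccSecondShellInt, v ≠ w → 8 ≤ sqNormInt (v - w) := by
  decide

/-- hcp: distinct second-shell vectors are at squared distance `≥ 48` (distance `≥ √(8/3)·a`).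
[folklore] -/
theorem hcp_second_shell_separated :
    ∀ v ∈ hcpSecondShellInt, ∀ w ∈ hcpSecondShellInt, v ≠ w → 48 ≤ sqNormInt (v - w) := by
  decide

/-! ## §2  The selector of card A: cap-regular particles -/

/-- **Cap-regular particle** (the near/far SELECTOR of card `gap-placed-handover`): at some scale
`a ∈ [47/50, 1]` particle `i` has exactly `12` other particles within `1.12·a`, all at distance
`≥ 0.89·a` from `x i` and pairwise `≥ 0.89·a` apart; NO particle in the open gap
`(1.12·a, 1.28·a)`; exactly `6` particles in the second annulus `[1.28·a, 1.5·a]`, each of them a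
SQUARE CAP: exactly four of the twelve lie within `1.12·a` of it.  All thresholds sit inside the
pair-distance gaps of the two-shell patterns (`(1.05, √2 − 0.05)·a` and `(1.1, √3 − 0.1)·a`), so
the predicate is decided by coordination topology, not by the metric tolerance `1/20`. [folklore] -/
def IsCapRegular {N : ℕ} (x : Fin N → E3) (i : Fin N) : Prop :=
  ∃ a : ℝ, 47 / 50 ≤ a ∧ a ≤ 1 ∧
    (Finset.univ.filter fun j : Fin N => j ≠ i ∧ dist (x j) (x i) ≤ 28 / 25 * a).card = 12 ∧
    (∀ j : Fin N, j ≠ i → dist (x j) (x i) ≤ 28 / 25 * a → 89 / 100 * a ≤ dist (x j) (x i)) ∧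
    (∀ j k : Fin N, j ≠ i → k ≠ i → j ≠ k → dist (x j) (x i) ≤ 28 / 25 * a →
        dist (x k) (x i) ≤ 28 / 25 * a → 89 / 100 * a ≤ dist (x j) (x k)) ∧
    (∀ j : Fin N, j ≠ i → ¬ (28 / 25 * a < dist (x j) (x i) ∧ dist (x j) (x i) < 32 / 25 * a)) ∧
    (Finset.univ.filter fun j : Fin N =>
        j ≠ i ∧ 32 / 25 * a ≤ dist (x j) (x i) ∧ dist (x j) (x i) ≤ 3 / 2 * a).card = 6 ∧
    (∀ j : Fin N, j ≠ i → 32 / 25 * a ≤ dist (x j) (x i) → dist (x j) (x i) ≤ 3 / 2 * a →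
        (Finset.univ.filter fun k : Fin N =>
            k ≠ i ∧ dist (x k) (x i) ≤ 28 / 25 * a ∧ dist (x k) (x j) ≤ 28 / 25 * a).card = 4)

/-- **Sub-regular particle**: its environment can be COMPLETED to a cap-regular one by adding
finitely many points (surface atoms, vacancy and void neighbours — "omission" defects); the
points are added as new particles of an enlarged configuration in which `i` keeps its label.
[folklore] -/
def IsSubRegular {N : ℕ} (x : Fin N → E3) (i : Fin N) : Prop :=
  ∃ (m : ℕ) (p : Fin m → E3), IsCapRegular (Fin.append x p) (Fin.castAdd m i)

/-- **Lemma A (card A, provable now):** a `1/20`-good particle on the window `[47/50, 1]` is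
cap-regular, at the scale of its goodness witness (pattern first shell in `[0.95a, 1.05a]`,
second shell in `[1.364a, 1.465a]`, nothing else within `3a/2`; caps by `fcc_cap_contacts` /
`hcp_cap_contacts`; separation by the `1`-separation of the patterns). [folklore] -/
def GoodImpCapRegular : Prop :=
  ∀ (N : ℕ) (x : Fin N → E3) (i : Fin N), IsTwoShellGood (1 / 20) (47 / 50) 1 x i → IsCapRegular x i

/-- **Lemma B (card A, the selector's rigidity — to be certified):** if `i` and every particle
within `3/2` of `x i` are cap-regular then `i` is two-shell good at the COARSE tolerance `1/8`
(two-way `a/8`-match of the `3a/2`-neighbourhood; note `1/8 > 3/2 − √2`, so this is used only as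
a metric distortion bound, not for the exact-`18` count, which cap-regularity supplies directly),
i.e. a cap-regular-cored particle is a distorted fcc/hcp two-shell, so that everything the far
field is relieved of lies in the elastic regime of the near field.  (Six square caps on a twelve-point near-kissing shell force the
cuboctahedral/anticuboctahedral contact combinatorics; the octet framework is rigid.) [folklore] -/
def CapRegularRigidity : Prop :=
  ∀ (N : ℕ) (x : Fin N → E3) (i : Fin N),
    (∀ j : Fin N, dist (x j) (x i) ≤ 3 / 2 → IsCapRegular x j) → IsTwoShellGood (1 / 8) (47 / 50) 1 x i

/-! ## §3  The sign fact: all bonds at a good particle are attractive -/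

/-- `V_LJ(r) < 0` as soon as `r ≥ 0.893` (`0.893⁶ = 0.50712… > 1/2`). [folklore] -/
theorem lennardJones_neg {r : ℝ} (hr : 893 / 1000 ≤ r) : lennardJones r < 0 := by
  have hr0 : 0 < r := lt_of_lt_of_le (by norm_num) hr
  have h6 : (1 / 2 : ℝ) < r ^ 6 := by
    calc (1 / 2 : ℝ) < (893 / 1000) ^ 6 := by norm_num
      _ ≤ r ^ 6 := by gcongr
  have hs : 0 < (r⁻¹) ^ 6 := by positivity
  have hs2 : (r⁻¹) ^ 6 < 2 := by
    rw [inv_pow]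
    rw [inv_lt_comm₀ (by positivity) (by norm_num)]
    linarith
  unfold lennardJones
  have h12 : (r⁻¹) ^ 12 = ((r⁻¹) ^ 6) ^ 2 := by ring
  rw [h12]
  nlinarith [mul_pos hs (sub_pos.2 hs2)]

/-- **Every other particle is at distance `≥ 0.893` from a `1/20`-good particle** (window
`[47/50, 1]`): particles within `3a/2` are matched to pattern points of norm `≥ a` within
`a/20`, hence at distance `≥ (19/20)·a ≥ (19/20)(47/50) = 0.893`; the others are at distance
`> 3a/2 ≥ 1.41`. [folklore] -/
theorem dist_ge_of_good {N : ℕ} {x : Fin N → E3} {i : Fin N}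
    (h : IsTwoShellGood (1 / 20) (47 / 50) 1 x i) {j : Fin N} (hj : j ≠ i) :
    893 / 1000 ≤ dist (x j) (x i) := by
  obtain ⟨a, ha₁, ha₂, A, P, f, hP, hf, hinj, hsurj⟩ := h
  have ha0 : 0 ≤ a := le_trans (by norm_num) ha₁
  by_cases hd : dist (x j) (x i) ≤ 3 / 2 * a
  · obtain ⟨v, hv, rfl⟩ := hsurj j hj hd
    have hv1 : 1 ≤ ‖v‖ := by
      have h2 : (1 : ℝ) ≤ Real.sqrt 2 := Real.one_le_sqrt.mpr (by norm_num)
      rcases hP with rfl | rfl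
      · rcases norm_of_mem_fccTwoShellPattern hv with h | h
        · rw [h]
        · rw [h]; exact h2
      · rcases norm_of_mem_hcpTwoShellPattern hv with h | h
        · rw [h]
        · rw [h]; exact h2
    have hAv : a ≤ dist (x i + a • A v) (x i) := by
      rw [dist_eq_norm, add_sub_cancel_left, norm_smul, Real.norm_of_nonneg ha0, A.norm_map]
      nlinarith
    have hmatch : dist (x (f v)) (x i + a • A v) ≤ 1 / 20 * a := (hf v hv).2
    have htri : dist (x i + a • A v) (x i) ≤ dist (x i + a • A v) (x (f v)) + dist (x (f v)) (x i) :=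
      dist_triangle _ _ _
    rw [dist_comm (x i + a • A v) (x (f v))] at htri
    nlinarith
  · push_neg at hd
    nlinarith

/-- **All bonds at a good particle are strictly attractive.**  Consequently, when a configuration
is cut into its good part `G` and the rest `B`, removing `B` only RAISES the site energies of
the particles of `G` (the free-surface boundary term has a sign), and the cross term
`∑_{i ∈ G, j ∈ B} V(|x_i − x_j|)` is negative termwise. [folklore] -/
theorem attractive_at_good {N : ℕ} {x : Fin N → E3} {i : Fin N}
    (h : IsTwoShellGood (1 / 20) (47 / 50) 1 x i) {j : Fin N} (hj : j ≠ i) :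
    lennardJones (dist (x i) (x j)) < 0 := by
  rw [dist_comm]
  exact lennardJones_neg (dist_ge_of_good h hj)

/-! ## §4  The near field IN VACUUM (omission defects only): card A's first milestone -/

/-- **Sub-good particle** (environment ⊆ pattern): some rotated, scaled fcc/hcp two-shell pattern
around `x i` accounts for EVERY particle within `3a/2` (injectively, within `a/20`), but pattern
points may be unoccupied.  Good particles are sub-good; so are surface atoms of a good cluster,
vacancy and void neighbours. [folklore] -/
def IsSubGood {N : ℕ} (x : Fin N → E3) (i : Fin N) : Prop :=
  ∃ a : ℝ, 47 / 50 ≤ a ∧ a ≤ 1 ∧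
    ∃ (A : E3 →ₗᵢ[ℝ] E3) (P : Finset E3) (g : Fin N → E3),
      (P = fccTwoShellPattern ∨ P = hcpTwoShellPattern) ∧
      (∀ j : Fin N, j ≠ i → dist (x j) (x i) ≤ 3 / 2 * a →
          g j ∈ P ∧ dist (x j) (x i + a • A (g j)) ≤ 1 / 20 * a) ∧
      Set.InjOn g {j : Fin N | j ≠ i ∧ dist (x j) (x i) ≤ 3 / 2 * a}

/-- **Omission gap** (the near field in vacuum): on configurations all of
whose particles are sub-good — distorted Barlow crystal with voids, vacancies and free surfaces,
no interstitial or frustrated matter anywhere — every particle that is not `1/20`-good pays a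
uniform `σ > 0` above `N·e*`.  This is `CoerciveTwoShellGap` RESTRICTED to sub-good
configurations; its boundary physics has a sign (missing bonds are missing ATTRACTIVE bonds, by
`attractive_at_good`), and the comparison with `e*` goes through the definition of the infimum
over layered competitors, never through a certificate. [folklore] -/
def OmissionGap : Prop :=
  ∀ δ : ℝ, 0 < δ → ∃ σ : ℝ, 0 < σ ∧ ∀ (N : ℕ) (x : Fin N → E3),
    (∀ i j : Fin N, i ≠ j → δ ≤ dist (x i) (x j)) → (∀ i : Fin N, IsSubGood x i) →
      (N : ℝ) * (⨅ Q : PeriodicConfiguration 3, Q.energyPerParticle lennardJones) +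
          σ * (Nat.card {i : Fin N // ¬ IsTwoShellGood (1 / 20) (47 / 50) 1 x i} : ℝ) ≤
        interactionEnergy lennardJones x

/-- `OmissionGap` is (trivially) implied by the crux: it is the crux restricted to a sub-class.
[folklore] -/
theorem omissionGap_of_crux
    (h : Summit.AtomisticToContinuum.Crystallization.Theses.PhononSlackCertificates.CoerciveTwoShellGap) :
    OmissionGap := by
  intro δ hδ
  obtain ⟨g, hg, hmain⟩ := h δ hδ
  exact ⟨g, hg, fun N x hsep _ => hmain N x hsep⟩


/-! ## §5  Lemma A, metric part (PROVED): the shell dichotomy and separation of a good environment -/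

/-- `1.414 < √2`. [folklore] -/
theorem sqrt_two_gt : (1414 / 1000 : ℝ) < Real.sqrt 2 := by
  rw [Real.lt_sqrt (by norm_num)]; norm_num

/-- `√2 < 1.415`. [folklore] -/
theorem sqrt_two_lt : Real.sqrt 2 < (1415 / 1000 : ℝ) := by
  rw [Real.sqrt_lt' (by norm_num)]; norm_num

/-- **Shell dichotomy of a good environment (the metric clauses of Lemma A, proved).**  At the
scale `a` of a `1/20`-goodness witness, every other particle within `3a/2` of `x i` lies EITHER in
the first annulus `[0.95a, 1.05a]` OR in the second annulus `[1.364a, 1.465a]` — so the gaps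
`(1.05a, 1.364a) ⊃ (1.12a, 1.28a)` and `(1.465a, 1.5a]` are EMPTY — and any two such particles
are `≥ 0.9a` apart.  These are clauses 2–4 of `IsCapRegular` with room; the counting clauses
(`12`, `6`, four contacts per cap) follow from the same matching with `card_fccTwoShellInt`,
`fcc_cap_contacts` etc. and are left to the line. [folklore] -/
theorem good_shell_dichotomy {N : ℕ} {x : Fin N → E3} {i : Fin N}
    (h : IsTwoShellGood (1 / 20) (47 / 50) 1 x i) :
    ∃ a : ℝ, 47 / 50 ≤ a ∧ a ≤ 1 ∧
      (∀ j : Fin N, j ≠ i → dist (x j) (x i) ≤ 3 / 2 * a →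
        (19 / 20 * a ≤ dist (x j) (x i) ∧ dist (x j) (x i) ≤ 21 / 20 * a) ∨
        (1364 / 1000 * a ≤ dist (x j) (x i) ∧ dist (x j) (x i) ≤ 1465 / 1000 * a)) ∧
      (∀ j k : Fin N, j ≠ i → k ≠ i → j ≠ k → dist (x j) (x i) ≤ 3 / 2 * a →
        dist (x k) (x i) ≤ 3 / 2 * a → 9 / 10 * a ≤ dist (x j) (x k)) := by
  obtain ⟨a, ha₁, ha₂, A, P, f, hP, hf, hinj, hsurj⟩ := h
  have ha0 : 0 ≤ a := le_trans (by norm_num) ha₁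
  have hnorm : ∀ v ∈ P, ‖v‖ = 1 ∨ ‖v‖ = Real.sqrt 2 := by
    intro v hv
    rcases hP with rfl | rfl
    · exact norm_of_mem_fccTwoShellPattern hv
    · exact norm_of_mem_hcpTwoShellPattern hv
  have hsep : ∀ v ∈ P, ∀ w ∈ P, v ≠ w → 1 ≤ dist v w := by
    intro v hv w hw hvw
    rcases hP with rfl | rfl
    · exact one_le_dist_of_mem_fccTwoShellPattern hv hw hvw
    · exact one_le_dist_of_mem_hcpTwoShellPattern hv hw hvw
  have hcen : ∀ v ∈ P, dist (x i + a • A v) (x i) = a * ‖v‖ := by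
    intro v _
    rw [dist_eq_norm, add_sub_cancel_left, norm_smul, Real.norm_of_nonneg ha0, A.norm_map]
  have hs1 := sqrt_two_gt
  have hs2 := sqrt_two_lt
  have has1 : a * (1414 / 1000) ≤ a * Real.sqrt 2 := mul_le_mul_of_nonneg_left hs1.le ha0
  have has2 : a * Real.sqrt 2 ≤ a * (1415 / 1000) := mul_le_mul_of_nonneg_left hs2.le ha0
  refine ⟨a, ha₁, ha₂, ?_, ?_⟩
  · intro j hj hd
    obtain ⟨v, hv, rfl⟩ := hsurj j hj hd
    have hm : dist (x (f v)) (x i + a • A v) ≤ 1 / 20 * a := (hf v hv).2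
    have h1 := dist_triangle (x (f v)) (x i + a • A v) (x i)
    have h2 := dist_triangle (x i + a • A v) (x (f v)) (x i)
    rw [hcen v hv] at h1 h2
    rw [dist_comm (x i + a • A v) (x (f v))] at h2
    rcases hnorm v hv with hn | hn
    · left
      rw [hn] at h1 h2
      constructor <;> nlinarith
    · right
      rw [hn] at h1 h2
      constructor <;> nlinarith
  · intro j k hj hk hjk hdj hdk
    obtain ⟨v, hv, rfl⟩ := hsurj j hj hdj
    obtain ⟨w, hw, rfl⟩ := hsurj k hk hdk
    have hvw : v ≠ w := fun heq => hjk (by rw [heq])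
    have hmv : dist (x (f v)) (x i + a • A v) ≤ 1 / 20 * a := (hf v hv).2
    have hmw : dist (x (f w)) (x i + a • A w) ≤ 1 / 20 * a := (hf w hw).2
    have hpat : dist (x i + a • A v) (x i + a • A w) = a * dist v w := by
      rw [dist_eq_norm, add_sub_add_left_eq_sub, ← smul_sub, norm_smul, Real.norm_of_nonneg ha0,
        ← map_sub, A.norm_map, dist_eq_norm]
    have h1 : a * 1 ≤ a * dist v w := mul_le_mul_of_nonneg_left (hsep v hv w hw hvw) ha0
    have t1 := dist_triangle4 (x i + a • A v) (x (f v)) (x (f w)) (x i + a • A w)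
    rw [hpat, dist_comm (x i + a • A v) (x (f v))] at t1
    nlinarith

/-- Corollary: at a good particle the open gap `(1.12a, 1.28a)` of `IsCapRegular` is empty and all
first-annulus particles are `≥ 0.95a ≥ 0.89a` from the centre (clauses 2 and 4). [folklore] -/
theorem good_gap_empty {N : ℕ} {x : Fin N → E3} {i : Fin N}
    (h : IsTwoShellGood (1 / 20) (47 / 50) 1 x i) :
    ∃ a : ℝ, 47 / 50 ≤ a ∧ a ≤ 1 ∧
      ∀ j : Fin N, j ≠ i → ¬ (28 / 25 * a < dist (x j) (x i) ∧ dist (x j) (x i) < 32 / 25 * a) := by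
  obtain ⟨a, ha₁, ha₂, hdich, -⟩ := good_shell_dichotomy h
  refine ⟨a, ha₁, ha₂, fun j hj hgap => ?_⟩
  have ha0 : 0 ≤ a := le_trans (by norm_num) ha₁
  have hd : dist (x j) (x i) ≤ 3 / 2 * a := by nlinarith [hgap.2]
  rcases hdich j hj hd with ⟨-, hhi⟩ | ⟨hlo, -⟩
  · nlinarith [hgap.1]
  · nlinarith [hgap.2]

end Summit.AtomisticToContinuum.Crystallization.Cruxes.CoerciveTwoShellGap.IdeatorTwo

end
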